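import Literature.Probability.RandomPlanarGeometry.LocalMartingaleProofs
import Literature.Probability.Distributions.GaussianMoments
import Mathlib.Probability.Independence.Integration
import HarnessLib

/-!
# `E(B_1² B_2 B_3) = 4`: a mixed moment of Brownian motion at three times
# (Durrett 2019, §7.1 Exercise 7.1.2)

[topic Probability/Process]

Topic `Probability/Process`, namespace `Literature.Probability.Process`; for the canonical Brownian
motion `B = Process.brownian` under the pre-Wiener measure `P = Process.preWienerMeasure`, raw
filtration `RandomPlanarGeometry.brownianFiltration`.  THEOREMS ONLY (no definition, no named fact,
no instance, no notation, no axiom).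

## The printed statement (R. Durrett, *Probability: Theory and Examples*, 5th ed., CUP 2019, §7.1
## Exercises, book p. 307 = PDF p0319 of the held copy `book:durrett2019-probability-theory-examples`),
## VERBATIM

"**7.1.2** Find `E(B_1² B_2 B_3)`."

The answer typed here: `E(B_1² B_2 B_3) = 4`.  Write `B_2 = B_1 + X`, `B_3 = B_2 + D` with
`X = B_2 − B_1`, `D = B_3 − B_2`: the increments are independent of the past and centred Gaussian with
variance `1` ((7.1.1)), so `E(B_1² B_2 D) = E(B_1² B_2)·E D = 0` and
`E(B_1² B_2²) = E B_1⁴ + 2 E B_1³ E X + E B_1² E X² = 3 + 0 + 1 = 4`.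

## What is typed

| Durrett 2019, §7.1 Exercise 7.1.2 | declaration | status |
|---|---|---|
| **`E(B_1² B_2 B_3) = 4`** | `Durrett2019_exercise_7_1_2` | proved |
| the steps `E(B_1² B_2²) = 4`, `E(B_1² B_2 (B_3 − B_2)) = 0` | `integral_brownian_one_sq_mul_brownian_two_sq`, `integral_brownian_one_sq_mul_brownian_two_mul_incr` | proved |

Tools: the laws `B_s ∼ N(0, s)`, `B_t − B_s ∼ N(0, t − s)` (Mathlib `IsPreBrownianReal.hasLaw_eval`,
`hasLaw_sub`), the Gaussian moments of the tree's `Distributions/GaussianMoments.lean`, the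
independence of `B_t − B_s` from `𝓕_s` (`RandomPlanarGeometry.indep_comap_brownian_sub_brownianFiltration`)
and Mathlib's `IndepFun.integral_mul_eq_mul_integral`, `IndepFun.integrable_mul`.

## References

* [Durrett2019] R. Durrett, *Probability: Theory and Examples*, 5th ed., CUP (2019),
  doi:10.1017/9781108591034, §7.1 Exercise 7.1.2 (p. 307, PDF p0319); (7.1.1).
-/

noncomputable section

open MeasureTheory ProbabilityTheory Filter Set
open scoped NNReal ENNReal Topology

namespace Literature.Probability.Process

/-! ### §1 Gaussian moments along the Brownian marginals and increments -/

/-- Moments transfer along a random variable with law `N(0, v)`. [folklore] -/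
private theorem integral_pow_of_hasLaw {X : (ℝ≥0 → ℝ) → ℝ} {v : ℝ≥0}
    (hX : HasLaw X (gaussianReal 0 v) preWienerMeasure) (k : ℕ) :
    ∫ ω, X ω ^ k ∂preWienerMeasure = ∫ x, x ^ k ∂(gaussianReal 0 v) := by
  have h := hX.integral_comp (f := fun x : ℝ ↦ x ^ k) (by fun_prop)
  simp only [Function.comp_def] at h
  exact h

/-- Integrability of powers along a random variable with law `N(0, v)`. [folklore] -/
private theorem integrable_pow_of_hasLaw {X : (ℝ≥0 → ℝ) → ℝ} {v : ℝ≥0}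
    (hX : HasLaw X (gaussianReal 0 v) preWienerMeasure) (k : ℕ) :
    Integrable (fun ω ↦ X ω ^ k) preWienerMeasure := by
  have h : Integrable (fun x : ℝ ↦ x ^ k) (preWienerMeasure.map X) := by
    rw [hX.map_eq]
    exact Distributions.integrable_pow_gaussianReal 0 v k
  exact (integrable_map_measure h.aestronglyMeasurable hX.aemeasurable).1 h

/-- `E X = 0` for `X ∼ N(0, v)`. [folklore] -/
private theorem integral_of_hasLaw {X : (ℝ≥0 → ℝ) → ℝ} {v : ℝ≥0}
    (hX : HasLaw X (gaussianReal 0 v) preWienerMeasure) : ∫ ω, X ω ∂preWienerMeasure = 0 := by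
  have h := integral_pow_of_hasLaw hX 1
  simp only [pow_one] at h
  rw [h, integral_id_gaussianReal]

/-- `E X² = v` for `X ∼ N(0, v)`. [folklore] -/
private theorem integral_sq_of_hasLaw {X : (ℝ≥0 → ℝ) → ℝ} {v : ℝ≥0}
    (hX : HasLaw X (gaussianReal 0 v) preWienerMeasure) : ∫ ω, X ω ^ 2 ∂preWienerMeasure = v := by
  rw [integral_pow_of_hasLaw hX 2]
  have h2 := Distributions.integral_pow_even_gaussianReal v 1
  norm_num [Nat.doubleFactorial] at h2
  exact h2

/-- `E X³ = 0` for `X ∼ N(0, v)`. [folklore] -/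
private theorem integral_pow_three_of_hasLaw {X : (ℝ≥0 → ℝ) → ℝ} {v : ℝ≥0}
    (hX : HasLaw X (gaussianReal 0 v) preWienerMeasure) : ∫ ω, X ω ^ 3 ∂preWienerMeasure = 0 := by
  rw [integral_pow_of_hasLaw hX 3]
  have h3 := Distributions.integral_pow_odd_gaussianReal v 1
  norm_num at h3
  exact h3

/-- `E X⁴ = 3v²` for `X ∼ N(0, v)`. [folklore] -/
private theorem integral_pow_four_of_hasLaw {X : (ℝ≥0 → ℝ) → ℝ} {v : ℝ≥0}
    (hX : HasLaw X (gaussianReal 0 v) preWienerMeasure) :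
    ∫ ω, X ω ^ 4 ∂preWienerMeasure = 3 * (v : ℝ) ^ 2 := by
  rw [integral_pow_of_hasLaw hX 4]
  have h4 := Distributions.integral_pow_even_gaussianReal v 2
  norm_num [Nat.doubleFactorial] at h4
  rw [h4]
  ring

/-- `B_1 ∼ N(0, 1)`. [folklore] -/
private theorem hasLaw_brownian_one : HasLaw (brownian 1) (gaussianReal 0 1) preWienerMeasure :=
  RandomPlanarGeometry.isPreBrownianReal_brownian.hasLaw_eval 1

/-- The increment `B_t − B_s` has law `N(0, |t − s|)` (Mathlib `IsPreBrownianReal.hasLaw_sub`,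
restated with the standard coercions). [folklore] -/
private theorem hasLaw_brownian_incr (s t : ℝ≥0) :
    HasLaw (brownian t - brownian s) (gaussianReal 0 (nndist (t : ℝ) (s : ℝ))) preWienerMeasure :=
  RandomPlanarGeometry.isPreBrownianReal_brownian.hasLaw_sub t s

/-- `B_2 − B_1 ∼ N(0, 1)`. [folklore] -/
private theorem hasLaw_brownian_two_sub_one :
    HasLaw (brownian 2 - brownian 1) (gaussianReal 0 1) preWienerMeasure := by
  have h := hasLaw_brownian_incr 1 2
  have h1 : nndist ((2 : ℝ≥0) : ℝ) ((1 : ℝ≥0) : ℝ) = 1 := by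
    apply NNReal.eq
    rw [coe_nndist, Real.dist_eq]
    norm_num
  rwa [h1] at h

/-- `B_3 − B_2 ∼ N(0, 1)`. [folklore] -/
private theorem hasLaw_brownian_three_sub_two :
    HasLaw (brownian 3 - brownian 2) (gaussianReal 0 1) preWienerMeasure := by
  have h := hasLaw_brownian_incr 2 3
  have h1 : nndist ((3 : ℝ≥0) : ℝ) ((2 : ℝ≥0) : ℝ) = 1 := by
    apply NNReal.eq
    rw [coe_nndist, Real.dist_eq]
    norm_num
  rwa [h1] at h

/-- The increments `B_2 − B_1`, `B_3 − B_2` are integrable. [folklore] -/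
private theorem integrable_brownian_two_sub_one : Integrable (brownian 2 - brownian 1) preWienerMeasure := by
  have h := integrable_pow_of_hasLaw hasLaw_brownian_two_sub_one 1
  simp only [pow_one] at h
  exact h

/-- The increment `B_3 − B_2` is integrable. [folklore] -/
private theorem integrable_brownian_three_sub_two :
    Integrable (brownian 3 - brownian 2) preWienerMeasure := by
  have h := integrable_pow_of_hasLaw hasLaw_brownian_three_sub_two 1
  simp only [pow_one] at h
  exact h

/-- The increment `B_t − B_s` is independent of any `𝓕_s`-measurable random variable. [folklore] -/
private theorem indepFun_incr_of_measurable {s t : ℝ≥0} (hst : s ≤ t) {G : (ℝ≥0 → ℝ) → ℝ}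
    (hG : Measurable[RandomPlanarGeometry.brownianFiltration s] G) :
    IndepFun (brownian t - brownian s) G preWienerMeasure := by
  rw [IndepFun_iff_Indep]
  exact indep_of_indep_of_le_right
    (RandomPlanarGeometry.indep_comap_brownian_sub_brownianFiltration hst) hG.comap_le

/-! ### §2 The two pieces and the answer -/

/-- **`E(B_1² B_2²) = E B_1⁴ + 2E(B_1³)E(B_2 − B_1) + E(B_1²)E((B_2 − B_1)²) = 3 + 0 + 1 = 4`.**
[cite: Durrett2019, §7.1 Exercise 7.1.2] -/
theorem integral_brownian_one_sq_mul_brownian_two_sq :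
    ∫ ω, brownian 1 ω ^ 2 * brownian 2 ω ^ 2 ∂preWienerMeasure = 4 := by
  haveI := RandomPlanarGeometry.isProbabilityMeasure_preWienerMeasure'
  set X : (ℝ≥0 → ℝ) → ℝ := brownian 2 - brownian 1 with hXdef
  have hX : ∀ ω, brownian 2 ω = brownian 1 ω + X ω := fun ω ↦ by
    simp only [hXdef, Pi.sub_apply]; ring
  have hind : IndepFun X (brownian 1) preWienerMeasure :=
    indepFun_incr_of_measurable one_le_two (RandomPlanarGeometry.adapted_brownian 1)
  -- the three pieces
  have h4 : ∫ ω, brownian 1 ω ^ 4 ∂preWienerMeasure = 3 := by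
    rw [integral_pow_four_of_hasLaw hasLaw_brownian_one]; norm_num
  have hi4 : Integrable (fun ω ↦ brownian 1 ω ^ 4) preWienerMeasure :=
    integrable_pow_of_hasLaw hasLaw_brownian_one 4
  have hind3 : IndepFun (fun ω ↦ brownian 1 ω ^ 3) X preWienerMeasure :=
    hind.symm.comp (measurable_id.pow_const 3) measurable_id
  have h3X : ∫ ω, brownian 1 ω ^ 3 * X ω ∂preWienerMeasure = 0 := by
    have h := hind3.integral_mul_eq_mul_integral
      ((measurable_brownian 1).pow_const 3).aestronglyMeasurable
      ((measurable_brownian 2).sub (measurable_brownian 1)).aestronglyMeasurable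
    rw [show ((fun ω ↦ brownian 1 ω ^ 3) * X) = fun ω ↦ brownian 1 ω ^ 3 * X ω from rfl] at h
    rw [h, integral_of_hasLaw hasLaw_brownian_two_sub_one, mul_zero]
  have hi3X : Integrable (fun ω ↦ brownian 1 ω ^ 3 * X ω) preWienerMeasure :=
    hind3.integrable_mul (integrable_pow_of_hasLaw hasLaw_brownian_one 3)
      integrable_brownian_two_sub_one
  have hind22 : IndepFun (fun ω ↦ brownian 1 ω ^ 2) (fun ω ↦ X ω ^ 2) preWienerMeasure :=
    hind.symm.comp (measurable_id.pow_const 2) (measurable_id.pow_const 2)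
  have h2X2 : ∫ ω, brownian 1 ω ^ 2 * X ω ^ 2 ∂preWienerMeasure = 1 := by
    have h := hind22.integral_mul_eq_mul_integral
      ((measurable_brownian 1).pow_const 2).aestronglyMeasurable
      (((measurable_brownian 2).sub (measurable_brownian 1)).pow_const 2).aestronglyMeasurable
    rw [show ((fun ω ↦ brownian 1 ω ^ 2) * fun ω ↦ X ω ^ 2) = fun ω ↦ brownian 1 ω ^ 2 * X ω ^ 2
      from rfl] at h
    rw [h, integral_sq_of_hasLaw hasLaw_brownian_one, integral_sq_of_hasLaw hasLaw_brownian_two_sub_one]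
    norm_num
  have hi2X2 : Integrable (fun ω ↦ brownian 1 ω ^ 2 * X ω ^ 2) preWienerMeasure :=
    hind22.integrable_mul (integrable_pow_of_hasLaw hasLaw_brownian_one 2)
      (integrable_pow_of_hasLaw hasLaw_brownian_two_sub_one 2)
  -- assemble
  have hsum : (fun ω ↦ brownian 1 ω ^ 2 * brownian 2 ω ^ 2) = fun ω ↦
      brownian 1 ω ^ 4 + 2 * (brownian 1 ω ^ 3 * X ω) + brownian 1 ω ^ 2 * X ω ^ 2 := by
    funext ω
    rw [hX ω]
    ring
  have hi42 : Integrable (fun ω ↦ brownian 1 ω ^ 4 + 2 * (brownian 1 ω ^ 3 * X ω)) preWienerMeasure :=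
    hi4.add (hi3X.const_mul 2)
  rw [hsum, integral_add hi42 hi2X2, integral_add hi4 (hi3X.const_mul 2),
    integral_const_mul, h4, h3X, h2X2]
  norm_num

/-- **`E(B_1² B_2 (B_3 − B_2)) = E(B_1² B_2) · E(B_3 − B_2) = 0`** (the increment after time `2` is
independent of `𝓕_2` and centred). [cite: Durrett2019, §7.1 Exercise 7.1.2] -/
theorem integral_brownian_one_sq_mul_brownian_two_mul_incr :
    ∫ ω, brownian 1 ω ^ 2 * brownian 2 ω * (brownian 3 ω - brownian 2 ω) ∂preWienerMeasure = 0 := by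
  haveI := RandomPlanarGeometry.isProbabilityMeasure_preWienerMeasure'
  have hG : Measurable[RandomPlanarGeometry.brownianFiltration 2]
      (fun ω ↦ brownian 1 ω ^ 2 * brownian 2 ω) :=
    (((RandomPlanarGeometry.adapted_brownian 1).mono
      (RandomPlanarGeometry.brownianFiltration.mono one_le_two) le_rfl).pow_const 2).mul
      (RandomPlanarGeometry.adapted_brownian 2)
  have hind : IndepFun (brownian 3 - brownian 2) (fun ω ↦ brownian 1 ω ^ 2 * brownian 2 ω)
      preWienerMeasure :=
    indepFun_incr_of_measurable (by norm_num) hG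
  have h := hind.symm.integral_mul_eq_mul_integral
    (((measurable_brownian 1).pow_const 2).mul (measurable_brownian 2)).aestronglyMeasurable
    ((measurable_brownian 3).sub (measurable_brownian 2)).aestronglyMeasurable
  rw [show ((fun ω ↦ brownian 1 ω ^ 2 * brownian 2 ω) * (brownian 3 - brownian 2)) =
      fun ω ↦ brownian 1 ω ^ 2 * brownian 2 ω * (brownian 3 ω - brownian 2 ω) from rfl] at h
  rw [h, integral_of_hasLaw hasLaw_brownian_three_sub_two, mul_zero]

/-- **Durrett, Exercise 7.1.2**: `E(B_1² B_2 B_3) = 4`. [cite: Durrett2019, §7.1 Exercise 7.1.2] -/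
theorem Durrett2019_exercise_7_1_2 :
    ∫ ω, brownian 1 ω ^ 2 * brownian 2 ω * brownian 3 ω ∂preWienerMeasure = 4 := by
  haveI := RandomPlanarGeometry.isProbabilityMeasure_preWienerMeasure'
  set X : (ℝ≥0 → ℝ) → ℝ := brownian 2 - brownian 1 with hXdef
  have hindX : IndepFun X (brownian 1) preWienerMeasure :=
    indepFun_incr_of_measurable one_le_two (RandomPlanarGeometry.adapted_brownian 1)
  -- integrability of `B_1² B_2²` and of `B_1² B_2 (B_3 − B_2)`
  have hi1 : Integrable (fun ω ↦ brownian 1 ω ^ 2 * brownian 2 ω ^ 2) preWienerMeasure := by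
    have hX : ∀ ω, brownian 2 ω = brownian 1 ω + X ω := fun ω ↦ by
      simp only [hXdef, Pi.sub_apply]; ring
    have hsum : (fun ω ↦ brownian 1 ω ^ 2 * brownian 2 ω ^ 2) = fun ω ↦
        brownian 1 ω ^ 4 + 2 * (brownian 1 ω ^ 3 * X ω) + brownian 1 ω ^ 2 * X ω ^ 2 := by
      funext ω
      rw [hX ω]
      ring
    rw [hsum]
    refine ((integrable_pow_of_hasLaw hasLaw_brownian_one 4).add ((IndepFun.integrable_mul
      (hindX.symm.comp (measurable_id.pow_const 3) measurable_id)
      (integrable_pow_of_hasLaw hasLaw_brownian_one 3)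
      integrable_brownian_two_sub_one).const_mul 2)).add
      (IndepFun.integrable_mul (hindX.symm.comp (measurable_id.pow_const 2) (measurable_id.pow_const 2))
        (integrable_pow_of_hasLaw hasLaw_brownian_one 2)
        (integrable_pow_of_hasLaw hasLaw_brownian_two_sub_one 2))
  have hi2 : Integrable (fun ω ↦ brownian 1 ω ^ 2 * brownian 2 ω * (brownian 3 ω - brownian 2 ω))
      preWienerMeasure := by
    -- `B_1² B_2 = B_1³ + B_1² X` is integrable, and independent of the increment `B_3 − B_2`
    have hG : Measurable[RandomPlanarGeometry.brownianFiltration 2]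
        (fun ω ↦ brownian 1 ω ^ 2 * brownian 2 ω) :=
      (((RandomPlanarGeometry.adapted_brownian 1).mono
        (RandomPlanarGeometry.brownianFiltration.mono one_le_two) le_rfl).pow_const 2).mul
        (RandomPlanarGeometry.adapted_brownian 2)
    have hind : IndepFun (brownian 3 - brownian 2) (fun ω ↦ brownian 1 ω ^ 2 * brownian 2 ω)
        preWienerMeasure := indepFun_incr_of_measurable (by norm_num) hG
    have hX : ∀ ω, brownian 2 ω = brownian 1 ω + X ω := fun ω ↦ by
      simp only [hXdef, Pi.sub_apply]; ring
    have hGi : Integrable (fun ω ↦ brownian 1 ω ^ 2 * brownian 2 ω) preWienerMeasure := by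
      have hsum : (fun ω ↦ brownian 1 ω ^ 2 * brownian 2 ω) =
          fun ω ↦ brownian 1 ω ^ 3 + brownian 1 ω ^ 2 * X ω := by
        funext ω
        rw [hX ω]
        ring
      rw [hsum]
      exact (integrable_pow_of_hasLaw hasLaw_brownian_one 3).add
        (IndepFun.integrable_mul (hindX.symm.comp (measurable_id.pow_const 2) measurable_id)
          (integrable_pow_of_hasLaw hasLaw_brownian_one 2)
          integrable_brownian_two_sub_one)
    have h := hind.symm.integrable_mul hGi
      integrable_brownian_three_sub_two
    exact h
  have hsplit : (fun ω ↦ brownian 1 ω ^ 2 * brownian 2 ω * brownian 3 ω) = fun ω ↦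
      brownian 1 ω ^ 2 * brownian 2 ω ^ 2 +
        brownian 1 ω ^ 2 * brownian 2 ω * (brownian 3 ω - brownian 2 ω) := by
    funext ω
    ring
  rw [hsplit, integral_add hi1 hi2, integral_brownian_one_sq_mul_brownian_two_sq,
    integral_brownian_one_sq_mul_brownian_two_mul_incr, add_zero]

end Literature.Probability.Process
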